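import Summits.BirchSwinnertonDyer.Rank1Residual.Additive.TateDataUnramifiedTorsion
import Summits.BirchSwinnertonDyer.Rank1Residual.Additive.TamagawaLocalTorsion
import HarnessLib

/-!
# The split-multiplicative Tamagawa witness WITHOUT the Kodaira–Néron converse, at places with
# no `p`-th roots of unity: `p ∣ c_v ⟹ q` is a `p`-th power `⟹ ∃ u ∈ H¹_ur ∖ 𝓚_v`
# (cell `b2b-bsdres`, team n1011, seat p16 GEN 4; row T-BUD5-K, closing note)

HONEST FRAMING (cell `b2b-bsdres`, run/shared/lean/b2b/bsd-rank1-residual/, verbatim in every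
file): the goal of the cell is to DELETE the COMBINATION-SHAPED residual classes of the
Birch–Swinnerton-Dyer formula for ALL analytic-rank `≤ 1` elliptic curves over `ℚ` — "full BSD
formula for every rank `≤ 1` curve in class `C`" assembled STRICTLY from published theorems — so
that the rank-`≤ 1` remainder becomes exactly the CONSTRUCTION-SHAPED classes, which are TYPED
(missing-input `Prop`s), NOT attempted. This is not "finishing BSD". Team n1011 (N10 / N11, the
Route-G budget node): research route; no claim beyond the stated classes; nothing is booked; marks
UNCHANGED. Theorems only: no definition, no named fact, no `sorry`.

## What and why

The multiplicative Tamagawa witness of the budget programme (this seat's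
`SplitMultiplicativeUnramifiedWitness` / `TateDataUnramifiedTorsion`) needs `q = u · r^p` for the
Tate parameter; `TateDataUnramifiedTorsion` derived it from UNRAMIFIED `p`-torsion ((L1), not in the
tree). Here is a second, (L1)-FREE supply, valid at every place `v ∤ p` whose completion has NO
non-trivial `p`-th root of unity (over `ℚ`: `ℓ ≢ 1 (mod p)`; the same congruence at every layer of
the cyclotomic `ℤ_p`-tower, the residue degrees being `p`-powers): by n1011-p06's reduction-type-free
`exists_point_ne_zero_zsmul_eq_zero_of_dvd_localTamagawaNumber`, `p ∣ c_v` gives a rational `T ≠ 0`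
with `pT = 0`; by Tate, `T = Φ(t)` with `t ∈ K_v^×`, `t^p = q^m`, `t ∉ q^ℤ`; if `p ∣ m` then
`(t/q^{m/p})^p = 1` forces `t ∈ q^ℤ` (no `p`-th roots of unity) — absurd — so `p ∤ m` and Bézout
makes `q = (t^a q^b)^p` a `p`-th power. Hence the witness, with A40 as the ONLY remaining input.

* `exists_pow_eq_of_tateData_of_torsion_of_forall_pow_eq_one` — Tate data + a rational point of
  order `p` + `μ_p(K_v) = 1` ⟹ `∃ r, q = r^p`.
* `exists_mem_unramifiedSubgroup_not_mem_kummerLocalConditionAt_of_tateData_of_dvd_localTamagawaNumber`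
  and the A40-packaged
  `…_of_tateUniformisation_of_dvd_localTamagawaNumber_of_forall_pow_eq_one (hU) (hsplit) (hpv)
  (hc : p ∣ c_v) (hμ) : ∃ u ∈ H¹_ur(K_v, E[p]), u ∉ 𝓚_v` — n1011-p10's binder, from the CENSUS
  datum `p ∣ c_v`, at every split multiplicative `v ∤ p` with `μ_p ⊄ K_v`, modulo A40 only.

References: Silverman *ATAEC* V.3.1, V.5.3; *AEC* VII.6; Greenberg LNM 1716 p. 74; Milne *ADT* I.3.3.
-/

noncomputable section

open scoped Classical

namespace WeierstrassCurve

open Literature.NumberTheory.EllipticCurves Literature.NumberTheory.GaloisRepresentations Field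
open Literature.NumberTheory.GaloisRepresentations.IsNonarchimedeanLocalField
open NumberField IsDedekindDomain ValuativeRel

section Local

variable {K : Type} [Field K] [NumberField K] (W : WeierstrassCurve K)
  {p : ℕ} [hp : Fact p.Prime] (v : HeightOneSpectrum (𝓞 K))

/-- **Tate data + a rational point of order `p` + no `p`-th roots of unity in `K_v` ⟹ `q` is a
`p`-th power in `K_v`** (only `q ≠ 0`, the kernel and rationality clauses are used). (`T = Φ(t)`,
`t ∈ K_v^×` by the rationality clause, `t^p = q^m` by the kernel clause; `p ∣ m` would give `(t q^{-m/p})^p = 1`, so `t ∈ q^ℤ` and `T = 0`; hence `p ∤ m` and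
`q = (t^a q^b)^p` with `a m + b p = 1`.) [cite: SilvermanATAEC1994, Ch. V Thm. 3.1 (c),(d) and Thm. 5.3 (a),(b)] -/
theorem exists_pow_eq_of_tateData_of_torsion_of_forall_pow_eq_one
    {q : v.adicCompletion K} (hq0 : q ≠ 0)
    (Φ : Additive (AlgebraicClosure (v.adicCompletion K))ˣ →+ localPoints W (v.adicCompletion K))
    (hker : ∀ u : (AlgebraicClosure (v.adicCompletion K))ˣ, Φ (Additive.ofMul u) = 0 ↔ ∃ n : ℤ,
        (u : AlgebraicClosure (v.adicCompletion K)) =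
          algebraMap (v.adicCompletion K) (AlgebraicClosure (v.adicCompletion K)) q ^ n)
    (hrat : ∀ P : localPoints W (v.adicCompletion K),
        (∀ σ : absoluteGaloisGroup (v.adicCompletion K), σ • P = P) →
        ∃ u : (v.adicCompletion K)ˣ,
          Φ (Additive.ofMul (Units.map (algebraMap (v.adicCompletion K)
            (AlgebraicClosure (v.adicCompletion K)) : v.adicCompletion K →*
              AlgebraicClosure (v.adicCompletion K)) u)) = P)
    (hμ : ∀ ζ : v.adicCompletion K, ζ ^ p = 1 → ζ = 1)
    {T : (W.baseChange (v.adicCompletion K)).toAffine.Point} (hT : T ≠ 0) (hpT : (p : ℤ) • T = 0) :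
    ∃ r : v.adicCompletion K, q = r ^ p := by
  haveI : CharZero (v.adicCompletion K) := charZero_adicCompletion v
  have hpp : p.Prime := hp.out
  have hιinj : Function.Injective
      (algebraMap (v.adicCompletion K) (AlgebraicClosure (v.adicCompletion K))) :=
    (algebraMap (v.adicCompletion K) (AlgebraicClosure (v.adicCompletion K))).injective
  -- the rational point `T` read in `E(K̄_v)` is `Γ`-fixed, hence `Φ(t)` with `t ∈ K_v^×`
  set P₀ : localPoints W (v.adicCompletion K) := W.baseChangeGeomPointsEquiv (v.adicCompletion K)
    (toGeomPoints (W.baseChange (v.adicCompletion K)) T) with hP₀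
  have hP₀fix : ∀ σ : absoluteGaloisGroup (v.adicCompletion K), σ • P₀ = P₀ := fun σ => by
    rw [hP₀, ← baseChangeGeomPointsEquiv_smul,
      toGeomPoints_mem_fixedPoints (W.baseChange (v.adicCompletion K)) T σ]
  obtain ⟨t, ht⟩ := hrat P₀ hP₀fix
  have hP₀0 : P₀ ≠ 0 := by
    intro h0
    apply hT
    apply toGeomPoints_injective (W.baseChange (v.adicCompletion K))
    apply (W.baseChangeGeomPointsEquiv (v.adicCompletion K)).injective
    rw [map_zero, map_zero]
    exact h0
  have hpP₀ : (p : ℤ) • P₀ = 0 := by rw [hP₀, ← map_zsmul, ← map_zsmul, hpT, map_zero, map_zero]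
  -- `t^p = q^m`
  have htp : Φ (Additive.ofMul ((Units.map (algebraMap (v.adicCompletion K)
      (AlgebraicClosure (v.adicCompletion K)) : v.adicCompletion K →*
        AlgebraicClosure (v.adicCompletion K)) t) ^ (p : ℤ))) = 0 := by
    rw [ofMul_zpow, map_zsmul, ht, hpP₀]
  obtain ⟨m, hm⟩ := (hker _).mp htp
  have htpq : (t : v.adicCompletion K) ^ p = q ^ m := by
    apply hιinj
    rw [map_pow, map_zpow₀]
    have h1 : (((Units.map (algebraMap (v.adicCompletion K) (AlgebraicClosure (v.adicCompletion K)) :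
        v.adicCompletion K →* AlgebraicClosure (v.adicCompletion K)) t) ^ (p : ℤ) :
          (AlgebraicClosure (v.adicCompletion K))ˣ) : AlgebraicClosure (v.adicCompletion K)) =
        (algebraMap (v.adicCompletion K) (AlgebraicClosure (v.adicCompletion K)) (t : v.adicCompletion K)) ^ p := by
      rw [Units.val_zpow_eq_zpow_val, zpow_natCast]; rfl
    rw [← h1, hm]
  have ht0 : (t : v.adicCompletion K) ≠ 0 := t.ne_zero
  -- `p ∤ m`: otherwise `t q^{-m/p}` is a `p`-th root of unity, so `t ∈ q^ℤ` and `P₀ = 0`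
  have hndvd : ¬ (p : ℤ) ∣ m := by
    rintro ⟨m', rfl⟩
    have hζ : ((t : v.adicCompletion K) * (q ^ m')⁻¹) ^ p = 1 := by
      rw [mul_pow, inv_pow, htpq, ← zpow_natCast (q ^ m'), ← zpow_mul, mul_comm m' (p : ℤ),
        mul_inv_cancel₀ (zpow_ne_zero _ hq0)]
    have ht1 : (t : v.adicCompletion K) = q ^ m' := by
      have h := hμ _ hζ
      rwa [mul_inv_eq_one₀ (zpow_ne_zero _ hq0)] at h
    apply hP₀0
    rw [← ht, hker]
    exact ⟨m', by change algebraMap _ _ (t : v.adicCompletion K) = _; rw [ht1, map_zpow₀]⟩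
  -- Bézout: `a m + b p = 1`, `q = (t^a q^b)^p`
  have hcop : IsCoprime m (p : ℤ) := by
    rw [Int.isCoprime_iff_gcd_eq_one]
    have hg : (Int.gcd m p : ℤ) ∣ (p : ℤ) := Int.gcd_dvd_right _ _
    have hprime : Prime (p : ℤ) := Nat.prime_iff_prime_int.mp hpp
    rcases (Nat.dvd_prime hpp).mp (by exact_mod_cast hg : Int.gcd m p ∣ p) with h | h
    · exact h
    · exfalso
      apply hndvd
      have : (Int.gcd m p : ℤ) ∣ m := Int.gcd_dvd_left _ _
      rw [h] at this
      exact this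
  obtain ⟨a, b, hab⟩ := hcop
  refine ⟨(t : v.adicCompletion K) ^ a * q ^ b, ?_⟩
  have e1 : ((t : v.adicCompletion K) ^ a) ^ p = ((t : v.adicCompletion K) ^ p) ^ a := by
    rw [← zpow_natCast ((t : v.adicCompletion K) ^ a), ← zpow_mul, mul_comm, zpow_mul, zpow_natCast]
  have e2 : (q ^ b) ^ p = q ^ (b * (p : ℤ)) := by
    rw [← zpow_natCast (q ^ b), ← zpow_mul]
  have hab' : m * a + b * (p : ℤ) = 1 := by rw [mul_comm m a]; exact hab
  symm
  calc ((t : v.adicCompletion K) ^ a * q ^ b) ^ p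
      = ((t : v.adicCompletion K) ^ p) ^ a * q ^ (b * (p : ℤ)) := by rw [mul_pow, e1, e2]
    _ = q ^ (m * a) * q ^ (b * (p : ℤ)) := by rw [htpq, ← zpow_mul]
    _ = q ^ (m * a + b * (p : ℤ)) := by rw [zpow_add₀ hq0]
    _ = q := by rw [hab', zpow_one]

/-- **The Tamagawa witness from `p ∣ c_v`-type torsion, at a Tate place with no `p`-th roots of
unity** (no Kodaira–Néron converse needed): Tate data `(q, Φ)` for `W` at `v ∤ p`, a rational point
`T ≠ 0` with `pT = 0` (n1011-p06's `exists_point_ne_zero_zsmul_eq_zero_of_dvd_localTamagawaNumber`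
supplies it from `p ∣ c_v`), and `μ_p(K_v) = 1` give `∃ u ∈ H¹_ur(K_v, E[p])`, `u ∉ 𝓚_v`.
[cite: SilvermanATAEC1994, Ch. V Thm. 3.1 (c),(d) and Thm. 5.3 (a),(b)]
[cite: GreenbergLNM1716, §3 p. 74 and Cor. 5.6 (proof)] -/
theorem exists_mem_unramifiedSubgroup_not_mem_kummerLocalConditionAt_of_tateData_of_point_of_forall_pow_eq_one
    [W.IsElliptic] (hpv : (p : 𝓞 K) ∉ v.asIdeal)
    {q : v.adicCompletion K} (hq0 : q ≠ 0) (hq1 : Valued.v q < 1)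
    (Φ : Additive (AlgebraicClosure (v.adicCompletion K))ˣ →+ localPoints W (v.adicCompletion K))
    (hsurj : Function.Surjective Φ)
    (hker : ∀ u : (AlgebraicClosure (v.adicCompletion K))ˣ, Φ (Additive.ofMul u) = 0 ↔ ∃ n : ℤ,
        (u : AlgebraicClosure (v.adicCompletion K)) =
          algebraMap (v.adicCompletion K) (AlgebraicClosure (v.adicCompletion K)) q ^ n)
    (hequiv : ∀ (σ : absoluteGaloisGroup (v.adicCompletion K))
        (u : (AlgebraicClosure (v.adicCompletion K))ˣ),
      σ • Φ (Additive.ofMul u) =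
        Φ (Additive.ofMul (Units.map (absoluteGaloisGroup.toAlgEquiv _ σ :
          AlgebraicClosure (v.adicCompletion K) →* _) u)))
    (hrat : ∀ P : localPoints W (v.adicCompletion K),
        (∀ σ : absoluteGaloisGroup (v.adicCompletion K), σ • P = P) →
        ∃ u : (v.adicCompletion K)ˣ,
          Φ (Additive.ofMul (Units.map (algebraMap (v.adicCompletion K)
            (AlgebraicClosure (v.adicCompletion K)) : v.adicCompletion K →*
              AlgebraicClosure (v.adicCompletion K)) u)) = P)
    (hμ : ∀ ζ : v.adicCompletion K, ζ ^ p = 1 → ζ = 1)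
    {T : (W.baseChange (v.adicCompletion K)).toAffine.Point} (hT : T ≠ 0) (hpT : (p : ℤ) • T = 0) :
    ∃ u ∈ DiscreteGaloisModule.unramifiedSubgroup
        ((W.torsionGaloisModule (p : ℤ)).restrictField (v.adicCompletion K)) 1,
      u ∉ W.kummerLocalConditionAt (p : ℤ) (v.adicCompletion K) := by
  obtain ⟨r, hr⟩ := W.exists_pow_eq_of_tateData_of_torsion_of_forall_pow_eq_one v hq0 Φ hker
    hrat hμ hT hpT
  exact W.exists_mem_unramifiedSubgroup_not_mem_kummerLocalConditionAt_of_tateData v hpv hq0 hq1 Φ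
    hsurj hker hequiv ⟨1, r, by rw [Units.val_one, OneMemClass.coe_one, one_mul]; exact hr⟩

/-- **`p ∣ c_v` at a split multiplicative `v ∤ p` with `μ_p ⊄ K_v ⟹` the Tamagawa witness, modulo
Tate's uniformisation ONLY.** For `E = W` over any number field `K`, `p` prime, `v ∤ p` a place of
split multiplicative reduction whose Tamagawa number `c_v` (`localTamagawaNumber` of `E ⊗ K_v`) is
divisible by `p`, and such that `K_v` contains no non-trivial `p`-th root of unity: granted the
named fact `Silverman1994_thmV53_tateUniformisation` (A40), `∃ u ∈ H¹_ur(K_v, E[p])`, `u ∉ 𝓚_v` —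
n1011-p10's binder `hwit` FROM THE CENSUS DATUM `p ∣ c_v`, with no unramified-torsion hypothesis
(n1011-p06's `exists_point_ne_zero_zsmul_eq_zero_of_dvd_localTamagawaNumber` + the previous
theorem). Over `ℚ` the side condition is `ℓ ≢ 1 (mod p)`; the `ℓ ≡ 1 (mod p)` places still need (L1).
CONDITIONAL on A40 (hypothesis `hU`). [cite: SilvermanATAEC1994, Ch. V Thm. 3.1 (c),(d) and Thm. 5.3 (a),(b)]
[cite: SilvermanAEC2009, Prop. VII.6.3 and Cor. VII.6.2] [cite: GreenbergLNM1716, §3 p. 74 and Cor. 5.6 (proof)] -/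
theorem exists_mem_unramifiedSubgroup_not_mem_kummerLocalConditionAt_of_tateUniformisation_of_dvd_localTamagawaNumber
    [W.IsElliptic] (hU : Silverman1994_thmV53_tateUniformisation.{0})
    (hsplit : W.HasSplitMultiplicativeReductionAt v) (hpv : (p : 𝓞 K) ∉ v.asIdeal)
    (hc : p ∣ (W.baseChange (v.adicCompletion K)).localTamagawaNumber (v.adicCompletionIntegers K))
    (hμ : ∀ ζ : v.adicCompletion K, ζ ^ p = 1 → ζ = 1) :
    ∃ u ∈ DiscreteGaloisModule.unramifiedSubgroup
        ((W.torsionGaloisModule (p : ℤ)).restrictField (v.adicCompletion K)) 1,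
      u ∉ W.kummerLocalConditionAt (p : ℤ) (v.adicCompletion K) := by
  obtain ⟨q, Φ, hq0, hq1, hsurj, hker, hequiv, hrat⟩ := hU W v hsplit
  obtain ⟨T, hT, hpT⟩ :=
    Summit.BirchSwinnertonDyer.Rank1Residual.Additive.exists_point_ne_zero_zsmul_eq_zero_of_dvd_localTamagawaNumber
      W p v hpv hc
  exact W.exists_mem_unramifiedSubgroup_not_mem_kummerLocalConditionAt_of_tateData_of_point_of_forall_pow_eq_one
    v hpv hq0 hq1 Φ hsurj hker hequiv hrat hμ hT hpT

end Local

end WeierstrassCurve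

/-! ## Erratum (seat n1011-p16 GEN 5, 2026-08-21; documentation only — no declaration above changes)

The sentences in this file that call (L1) — "at a (split) multiplicative place `v ∤ p` with
`p ∣ ord_v(Δ_min)` the inertia group acts trivially on `E[p]`" — "NOT proved in the tree" /
"not in the tree" / "n1011-p14's deal" are RETIRED. (L1) IS a tree theorem, and was when this file
landed: `WeierstrassCurve.smul_eq_of_mem_inertia_of_hasMultiplicativeReductionAt_of_dvd`
(`Literature/NumberTheory/EllipticCurves/MultiplicativeUnramifiedTorsionProofs.lean`, in the tree since
2026-08-16; Kodaira–Néron over `K_v^nr`, no Tate curve; Serre, Invent. Math. 15 (1972) n° 1.12;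
Silverman *ATAEC* Ex. 5.13 (b)), read on `absInertia K_v` through
`IsDedekindDomain.HeightOneSpectrum.inertia_eq_absInertia`
(`KodairaNeronUnramifiedInertiaProofs.lean`). The residual case `μ_p ⊂ K_v` (over `ℚ`: `ℓ ≡ 1 (mod p)`) that this file left to (L1) is
thereby discharged from `p ∣ ord_v(Δ_min)`, i.e. from the census datum `p ∣ c_v` at a split
multiplicative place (`localTamagawaNumber_eq_ordMinimalDiscriminant_of_hasSplitMultiplicativeReductionAt`),
modulo A40 only and with NO `μ_p ⊄ K_v` side condition, in n1011-p01's row T-L1-KN file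
`Summits/BirchSwinnertonDyer/Rank1Residual/Additive/SplitMultiplicativeWitnessOfTamagawa.lean` (p276169):
`forall_absInertia_smul_eq_of_dvd_ordMinimalDiscriminant`,
`exists_mem_unramifiedSubgroup_not_mem_kummerLocalConditionAt_of_tateUniformisation_of_split_of_dvd_localTamagawaNumber`
(any number field `K`, any split multiplicative `v ∤ p`) and
`exists_mem_unramifiedSubgroup_not_mem_kummerLocalConditionAt_baseChange_of_split_of_dvd_localTamagawaNumber`
(`V/ℚ` globally minimal, any number field, any place above the Tamagawa prime). The cell's
"(L1) residual scope" (lead R5-54) is EMPTY. -/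

end
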